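import Mathlib
import Summits.NavierStokesRegularity.NavierStokesRegularity.Theorems.EulerZoomLiouvillePowerGaugeEulerLiouvilleWeakTraceGeneral
import HarnessLib

/-!
# Crux `EulerZoomLiouville.PowerGaugeEulerLiouville` (stmt-NavierStokesRegularity-19832): THE WEAK TRACE LAW WITH A LOGARITHM — plate t60-WTLOG of nsreg-p2 ROUND-56 «THE LOGARITHM'S PRICE»

Width/portrait piece for THE ONE STATEMENT `stub_selfSimilarC2Needle` (LEAD skeleton `Cruxes/PowerGaugeEulerLiouville/Lines/birth.lean`
v112, ns-typeII-p2 g16), `--supports stmt-NavierStokesRegularity-19832 --as helper`.  Text and proofs = nsreg-p2 g45's `r56/Sketch56.lean`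
(sha16 caee30280605acd0, namespace `NsregP2.R56.Log`) §S + §W VERBATIM, the statement `WeakTraceLawLog ρ V` (= Seed55 / Sketch55 text)
UNFOLDED so that this file stays definition-free.

Setting (R52–R56): a `C²` self-similar Euler profile `(V, P)` with `γ = 1/(2+ρ)`, centre `0`, under the A-gauge on balls
`∫_{B_R}‖V‖² ≤ A R^{1−2ρ}` (`R ≥ 1`) and the HONEST pressure budget WITH ITS LOGARITHM `∫_{B_R}|P| ≤ D R^{1−2ρ} log R` (`R ≥ 2`).

CONTENTS (all PROVED, std axioms):
* §S `hasDerivAt_logMajorant`, `exists_limit_of_deriv_bound_log` — the monotone sandwich of `TwoSidedMoment.exists_limit_of_deriv_bound`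
  with the logarithmic majorant `M(R) = K R^{−δ}(δ+1+δ log R)/δ²`: `|G′| ≤ K R^{−1−δ}(1 + log R)` (`R ≥ 1`) ⇒
  `|G(R) − L| ≤ K(δ+1)/δ² · R^{−δ}(1 + log R)`;
* §W ★★ `weakTraceLawLog (hρ : -2 < ρ) V` — R54's full `𝒟′` trace law under the log-budget: for every `C¹_c` test `φ` there are `L, C`
  with `|l^{ρ−2}∫⟪V, φ(l⁻¹·)⟫ − L| ≤ C l^{−(2+ρ)}(1 + log l)` (`l ≥ 2`) — from the LANDED `WeakTrace.traceDerivativeIdentity` (t59-TR(b),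
  ns-ezl-w3 g8) + the two budgets: `|F′(l)| ≤ (2+ρ)(B₁A′ + B₂D′(1+log r′)) r′^{1−2ρ} · l^{−3−ρ}(1 + log l)`, then §S.

HONEST FRAMING: a portrait instrument about HYPOTHETICAL profiles; the log-free Π-budget is NOT claimed (R56 §3: it needs the `L log L`
endpoint of Calderón–Zygmund, a Literature fact to be typed); nothing here bears on the crux E (19832, OPEN) or on NS regularity;
«hard core evaded: NO».
[nsreg-p2 R56 §S/§W t60-WTLOG; cite: ConstantinIgnatovaVicol2026Putative, §3.4.1]
-/

noncomputable section

set_option linter.dupNamespace false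

open MeasureTheory Set Filter Topology Metric Function TopologicalSpace
open scoped ENNReal NNReal RealInnerProductSpace Topology

namespace Summit.NavierStokesRegularity.NavierStokesRegularity.Theorems.PowerGaugeEulerLiouville.WeakTrace

open Literature.Analysis Literature.Analysis.FluidPDE
open Summit.NavierStokesRegularity.NavierStokesRegularity.Theorems.PowerGaugeEulerLiouville

/-! ## §S  The monotone sandwich with a logarithmic majorant -/

/-- The logarithmic majorant `M(R) = K R^{−δ}(δ + 1 + δ log R)/δ²` has `M′(R) = −K R^{−1−δ}(1 + log R)`. [nsreg-p2 R56 §S; folklore] -/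
theorem hasDerivAt_logMajorant {K δ R : ℝ} (hδ : δ ≠ 0) (hR : 0 < R) :
    HasDerivAt (fun R : ℝ => K / δ ^ 2 * (R ^ (-δ) * (δ + 1 + δ * Real.log R)))
      (-(K * R ^ (-1 - δ) * (1 + Real.log R))) R := by
  have h1 : HasDerivAt (fun x : ℝ => x ^ (-δ)) (-δ * R ^ (-δ - 1)) R :=
    Real.hasDerivAt_rpow_const (Or.inl hR.ne')
  have h2 : HasDerivAt (fun x : ℝ => δ + 1 + δ * Real.log x) (δ * R⁻¹) R := by
    simpa using ((Real.hasDerivAt_log hR.ne').const_mul δ).const_add (δ + 1)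
  have h3 := (h1.mul h2).const_mul (K / δ ^ 2)
  refine h3.congr_deriv ?_
  have he : -δ - 1 = -1 - δ := by ring
  have hsplit : R ^ (-δ) * (δ * R⁻¹) = δ * R ^ (-1 - δ) := by
    rw [← he, Real.rpow_sub_one hR.ne', div_eq_mul_inv]; ring
  rw [hsplit, he]
  field_simp
  ring

/-- **Limit with rate from a logarithmic power bound on the derivative**: if `G` is differentiable on `(0,∞)` with
`|G′(R)| ≤ K·R^{−1−δ}(1 + log R)` for `R ≥ 1` (`δ > 0`, `K ≥ 0`), then there is `L` with
`|G(R) − L| ≤ K(δ+1)/δ² · R^{−δ}(1 + log R)` for all `R ≥ 1`. [nsreg-p2 R56 §S; monotone sandwich, as `TwoSidedMoment.exists_limit_of_deriv_bound`; folklore] -/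
theorem exists_limit_of_deriv_bound_log {G G' : ℝ → ℝ} {K δ : ℝ} (hδ : 0 < δ) (hK : 0 ≤ K)
    (hG : ∀ R : ℝ, 0 < R → HasDerivAt G (G' R) R)
    (hbd : ∀ R : ℝ, 1 ≤ R → |G' R| ≤ K * R ^ (-1 - δ) * (1 + Real.log R)) :
    ∃ L : ℝ, ∀ R : ℝ, 1 ≤ R → |G R - L| ≤ K * (δ + 1) / δ ^ 2 * R ^ (-δ) * (1 + Real.log R) := by
  set M : ℝ → ℝ := fun R => K / δ ^ 2 * (R ^ (-δ) * (δ + 1 + δ * Real.log R)) with hMdef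
  set Hp : ℝ → ℝ := fun R => G R + M R with hHpdef
  set Hm : ℝ → ℝ := fun R => G R - M R with hHmdef
  have hpow : ∀ R : ℝ, 0 < R → HasDerivAt M (-(K * R ^ (-1 - δ) * (1 + Real.log R))) R :=
    fun R hR => hasDerivAt_logMajorant hδ.ne' hR
  have hHp : ∀ R : ℝ, 0 < R → HasDerivAt Hp (G' R + -(K * R ^ (-1 - δ) * (1 + Real.log R))) R :=
    fun R hR => (hG R hR).add (hpow R hR)
  have hHm : ∀ R : ℝ, 0 < R → HasDerivAt Hm (G' R - -(K * R ^ (-1 - δ) * (1 + Real.log R))) R :=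
    fun R hR => (hG R hR).sub (hpow R hR)
  have hanti : AntitoneOn Hp (Ici 1) := by
    refine antitoneOn_of_hasDerivWithinAt_nonpos (convex_Ici 1) (f' := fun R => G' R + -(K * R ^ (-1 - δ) * (1 + Real.log R)))
      (fun R hR => (hHp R (by linarith [mem_Ici.1 hR])).continuousAt.continuousWithinAt) ?_ ?_
    · intro R hR
      rw [interior_Ici] at hR
      exact (hHp R (by linarith [mem_Ioi.1 hR])).hasDerivWithinAt
    · intro R hR
      rw [interior_Ici] at hR
      have := (abs_le.1 (hbd R (le_of_lt hR))).2
      linarith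
  have hmono : MonotoneOn Hm (Ici 1) := by
    refine monotoneOn_of_hasDerivWithinAt_nonneg (convex_Ici 1) (f' := fun R => G' R - -(K * R ^ (-1 - δ) * (1 + Real.log R)))
      (fun R hR => (hHm R (by linarith [mem_Ici.1 hR])).continuousAt.continuousWithinAt) ?_ ?_
    · intro R hR
      rw [interior_Ici] at hR
      exact (hHm R (by linarith [mem_Ioi.1 hR])).hasDerivWithinAt
    · intro R hR
      rw [interior_Ici] at hR
      have := (abs_le.1 (hbd R (le_of_lt hR))).1
      linarith
  have hMnn : ∀ R : ℝ, 1 ≤ R → 0 ≤ M R := by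
    intro R hR
    have hlog : 0 ≤ Real.log R := Real.log_nonneg hR
    have : 0 ≤ R ^ (-δ) := Real.rpow_nonneg (by linarith) _
    simp only [hMdef]
    positivity
  have hle : ∀ R : ℝ, 1 ≤ R → Hm R ≤ Hp R := by
    intro R hR
    have := hMnn R hR
    simp only [hHpdef, hHmdef]
    linarith
  have hbdd : BddAbove (Hm '' Ici 1) := by
    refine ⟨Hp 1, ?_⟩
    rintro _ ⟨R, hR, rfl⟩
    exact (hle R hR).trans (hanti (self_mem_Ici) hR hR)
  have hne : (Hm '' Ici 1).Nonempty := ⟨Hm 1, 1, self_mem_Ici, rfl⟩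
  refine ⟨sSup (Hm '' Ici 1), fun R hR => ?_⟩
  have h1 : Hm R ≤ sSup (Hm '' Ici 1) := le_csSup hbdd ⟨R, hR, rfl⟩
  have h2 : sSup (Hm '' Ici 1) ≤ Hp R := by
    refine csSup_le hne ?_
    rintro _ ⟨R', hR', rfl⟩
    have hmax : max R R' ∈ Ici (1 : ℝ) := le_trans hR (le_max_left _ _)
    calc Hm R' ≤ Hm (max R R') := hmono hR' hmax (le_max_right _ _)
      _ ≤ Hp (max R R') := hle _ hmax
      _ ≤ Hp R := hanti hR hmax (le_max_left _ _)
  -- `|G R − L| ≤ M R ≤ K(δ+1)/δ² · R^{−δ}(1 + log R)`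
  have hM : M R ≤ K * (δ + 1) / δ ^ 2 * R ^ (-δ) * (1 + Real.log R) := by
    have hlog : 0 ≤ Real.log R := Real.log_nonneg hR
    have hRδ : 0 ≤ R ^ (-δ) := Real.rpow_nonneg (by linarith) _
    simp only [hMdef]
    rw [show K / δ ^ 2 * (R ^ (-δ) * (δ + 1 + δ * Real.log R)) = K / δ ^ 2 * R ^ (-δ) * (δ + 1 + δ * Real.log R) by ring,
      show K * (δ + 1) / δ ^ 2 * R ^ (-δ) * (1 + Real.log R) = K / δ ^ 2 * R ^ (-δ) * ((δ + 1) * (1 + Real.log R)) by ring]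
    apply mul_le_mul_of_nonneg_left _ (by positivity)
    nlinarith
  simp only [hHpdef, hHmdef] at h1 h2
  rw [abs_sub_le_iff]
  constructor <;> linarith

/-! ## §W  The weak trace law with a logarithm — PROVED -/

/-- ★ **THE WEAK TRACE LAW WITH A LOGARITHM, PROVED for every `ρ > −2`** (plate t60-WTLOG; text = `NsregP2.R55.Pinch.WeakTraceLawLog ρ V` =
`NsregP2.R56.Log.WeakTraceLawLog ρ V`, Seed55 VERBATIM, unfolded): under the A-gauge on balls and the HONEST pressure budget
`∫_{B_R}|P| ≤ D R^{1−2ρ} log R` (`R ≥ 2`) every `C¹_c` vector test has a `𝒟′`-trace limit with rate `C l^{−(2+ρ)}(1 + log l)`: the proof of the LANDED `WeakTrace.weakTraceLaw_allTests` (p709657) with the pressure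
budget `∫_{B_R}|P| ≤ D R^{1−2ρ} log R` (`R ≥ 2`): `|F′(l)| ≤ (2+ρ)(B₁A′ + B₂D′(1 + log r′)) r′^{1−2ρ} · l^{−3−ρ}(1 + log l)` for `l ≥ 1`
(`supp φ ⊆ B̄_r`, `r′ = max r 2`, `log(r′l) ≤ (1 + log r′)(1 + log l)`), then `exists_limit_of_deriv_bound_log`.
By-name check: `example (hρ : -2 < ρ) (V) : NsregP2.R55.Pinch.WeakTraceLawLog ρ V := WeakTrace.weakTraceLawLog hρ V`.
[nsreg-p2 R56 §W t60-WTLOG; cite: ConstantinIgnatovaVicol2026Putative, §3.4.1; Stein 1970 Ch. II §6.2(b) for the (unused here) `L log L` price] -/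
theorem weakTraceLawLog {ρ : ℝ} (hρ : -2 < ρ) (V : EuclideanSpace ℝ (Fin 3) → EuclideanSpace ℝ (Fin 3)) :
    ∀ P : EuclideanSpace ℝ (Fin 3) → ℝ, IsSelfSimilarEulerProfile (1 / (2 + ρ)) 0 V P →
    (∃ A : ℝ, ∀ R : ℝ, 1 ≤ R → ∫ y in ball (0 : EuclideanSpace ℝ (Fin 3)) R, ‖V y‖ ^ 2 ≤ A * R ^ (1 - 2 * ρ)) →
    (∃ D : ℝ, ∀ R : ℝ, 2 ≤ R → ∫ y in ball (0 : EuclideanSpace ℝ (Fin 3)) R, |P y| ≤ D * R ^ (1 - 2 * ρ) * Real.log R) →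
    ∀ φ : EuclideanSpace ℝ (Fin 3) → EuclideanSpace ℝ (Fin 3), ContDiff ℝ 1 φ → HasCompactSupport φ →
      ∃ L C : ℝ, ∀ l : ℝ, 2 ≤ l →
        |l ^ (ρ - 2) * (∫ y, ⟪V y, φ (l⁻¹ • y)⟫) - L| ≤ C * l ^ (-(2 + ρ)) * (1 + Real.log l) := by
  intro P hprof hA hD φ hφ hφc
  have h2ρ : 0 < 2 + ρ := by linarith
  have hVc : Continuous V := hprof.contDiff_velocity.continuous
  have hPc : Continuous P := hprof.contDiff_pressure.continuous
  obtain ⟨B₀, B₁, r, hB₀, hB₁, hr, hφB, hDφB, hφ0, hDφ0⟩ := exists_bounds_of_vectorWeight hφ hφc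
  obtain ⟨A, hA⟩ := hA
  obtain ⟨D, hD⟩ := hD
  set A' : ℝ := max A 0 with hA'def
  have hA'0 : 0 ≤ A' := le_max_right _ _
  set D' : ℝ := max D 0 with hD'def
  have hD'0 : 0 ≤ D' := le_max_right _ _
  set r' : ℝ := max r 2 with hr'def
  have hr'2 : 2 ≤ r' := le_max_right _ _
  have hr'1 : 1 ≤ r' := by linarith
  have hr'0 : 0 < r' := by linarith
  have hlogr' : 0 ≤ Real.log r' := Real.log_nonneg hr'1
  have hDφ0' : ∀ x, r' ≤ ‖x‖ → fderiv ℝ φ x = 0 := fun x hx => hDφ0 x (le_trans (le_max_left _ _) hx)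
  -- a bound for the divergence of `φ`
  have hdivc : Continuous (VectorCalculus.divergence φ) := continuous_divergence (hφ.continuous_fderiv one_ne_zero)
  have hdivsupp : HasCompactSupport (VectorCalculus.divergence φ) := by
    refine (hφc.fderiv (𝕜 := ℝ)).mono fun x hx => ?_
    rw [mem_support] at hx ⊢
    contrapose! hx
    exact divergence_eq_zero_of_fderiv_eq_zero hx
  obtain ⟨B₂, hB₂⟩ := hdivsupp.exists_bound_of_continuous hdivc
  have hB₂0 : 0 ≤ B₂ := (norm_nonneg _).trans (hB₂ 0)
  have hfar_of : ∀ {l : ℝ}, 0 < l → ∀ {y : EuclideanSpace ℝ (Fin 3)}, r' * l ≤ ‖y‖ → r' ≤ ‖l⁻¹ • y‖ := fun {l} hl {y} hy => by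
    rw [norm_smul, norm_inv, Real.norm_eq_abs, abs_of_pos hl, le_inv_mul_iff₀ hl]; linarith
  -- the quadratic term: `|∫⟪V, Dφ(l⁻¹y)[V]⟫| ≤ B₁ A' (r'l)^{1−2ρ}`
  have hK : ∀ l : ℝ, 1 ≤ l → |∫ y, ⟪V y, fderiv ℝ φ (l⁻¹ • y) (V y)⟫| ≤ B₁ * (A' * (r' * l) ^ (1 - 2 * ρ)) := by
    intro l hl
    have hl0 : 0 < l := by linarith
    have hint2 : IntegrableOn (fun y => ‖V y‖ ^ 2) (ball (0 : EuclideanSpace ℝ (Fin 3)) (r' * l)) :=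
      ((hVc.norm.pow 2).continuousOn.integrableOn_compact (isCompact_closedBall (0 : EuclideanSpace ℝ (Fin 3)) (r' * l))).mono_set
        ball_subset_closedBall
    have hind : ∀ y, ‖⟪V y, fderiv ℝ φ (l⁻¹ • y) (V y)⟫‖ ≤
        (ball (0 : EuclideanSpace ℝ (Fin 3)) (r' * l)).indicator (fun y => B₁ * ‖V y‖ ^ 2) y := by
      intro y
      by_cases hy : y ∈ ball (0 : EuclideanSpace ℝ (Fin 3)) (r' * l)
      · rw [indicator_of_mem hy]
        calc ‖⟪V y, fderiv ℝ φ (l⁻¹ • y) (V y)⟫‖ ≤ ‖V y‖ * ‖fderiv ℝ φ (l⁻¹ • y) (V y)‖ := norm_inner_le_norm _ _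
          _ ≤ ‖V y‖ * (B₁ * ‖V y‖) := mul_le_mul_of_nonneg_left
              (((fderiv ℝ φ (l⁻¹ • y)).le_opNorm _).trans (mul_le_mul_of_nonneg_right (hDφB _) (norm_nonneg _))) (norm_nonneg _)
          _ = B₁ * ‖V y‖ ^ 2 := by ring
      · rw [indicator_of_notMem hy]
        rw [mem_ball_zero_iff, not_lt] at hy
        rw [hDφ0' _ (hfar_of hl0 hy), zero_apply, inner_zero_right, norm_zero]
    calc |∫ y, ⟪V y, fderiv ℝ φ (l⁻¹ • y) (V y)⟫| = ‖∫ y, ⟪V y, fderiv ℝ φ (l⁻¹ • y) (V y)⟫‖ := (Real.norm_eq_abs _).symm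
      _ ≤ ∫ y, (ball (0 : EuclideanSpace ℝ (Fin 3)) (r' * l)).indicator (fun y => B₁ * ‖V y‖ ^ 2) y :=
          norm_integral_le_of_norm_le ((integrable_indicator_iff measurableSet_ball).2 (hint2.const_mul B₁)) (ae_of_all _ hind)
      _ = B₁ * ∫ y in ball (0 : EuclideanSpace ℝ (Fin 3)) (r' * l), ‖V y‖ ^ 2 := by
          rw [integral_indicator measurableSet_ball, integral_const_mul]
      _ ≤ B₁ * (A' * (r' * l) ^ (1 - 2 * ρ)) := by
          refine mul_le_mul_of_nonneg_left ?_ hB₁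
          have hrl : 1 ≤ r' * l := by nlinarith
          exact (hA (r' * l) hrl).trans (mul_le_mul_of_nonneg_right (le_max_left _ _) (Real.rpow_nonneg (by positivity) _))
  -- the pressure term, WITH THE LOGARITHM: `|∫ P·div φ(l⁻¹y)| ≤ B₂ D' (r'l)^{1−2ρ} log(r'l)`
  have hPr : ∀ l : ℝ, 1 ≤ l → |∫ y, P y * VectorCalculus.divergence φ (l⁻¹ • y)| ≤
      B₂ * (D' * (r' * l) ^ (1 - 2 * ρ) * Real.log (r' * l)) := by
    intro l hl
    have hl0 : 0 < l := by linarith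
    have hrl2 : 2 ≤ r' * l := by nlinarith
    have hlogrl : 0 ≤ Real.log (r' * l) := Real.log_nonneg (by linarith)
    have hintP : IntegrableOn (fun y => |P y|) (ball (0 : EuclideanSpace ℝ (Fin 3)) (r' * l)) :=
      (hPc.abs.continuousOn.integrableOn_compact (isCompact_closedBall (0 : EuclideanSpace ℝ (Fin 3)) (r' * l))).mono_set ball_subset_closedBall
    have hind : ∀ y, ‖P y * VectorCalculus.divergence φ (l⁻¹ • y)‖ ≤
        (ball (0 : EuclideanSpace ℝ (Fin 3)) (r' * l)).indicator (fun y => B₂ * |P y|) y := by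
      intro y
      by_cases hy : y ∈ ball (0 : EuclideanSpace ℝ (Fin 3)) (r' * l)
      · rw [indicator_of_mem hy, Real.norm_eq_abs, abs_mul]
        have hb : |VectorCalculus.divergence φ (l⁻¹ • y)| ≤ B₂ := by
          have := hB₂ (l⁻¹ • y); rwa [Real.norm_eq_abs] at this
        calc |P y| * |VectorCalculus.divergence φ (l⁻¹ • y)| ≤ |P y| * B₂ := mul_le_mul_of_nonneg_left hb (abs_nonneg _)
          _ = B₂ * |P y| := mul_comm _ _
      · rw [indicator_of_notMem hy]
        rw [mem_ball_zero_iff, not_lt] at hy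
        rw [divergence_eq_zero_of_fderiv_eq_zero (hDφ0' _ (hfar_of hl0 hy)), mul_zero, norm_zero]
    calc |∫ y, P y * VectorCalculus.divergence φ (l⁻¹ • y)| = ‖∫ y, P y * VectorCalculus.divergence φ (l⁻¹ • y)‖ := (Real.norm_eq_abs _).symm
      _ ≤ ∫ y, (ball (0 : EuclideanSpace ℝ (Fin 3)) (r' * l)).indicator (fun y => B₂ * |P y|) y :=
          norm_integral_le_of_norm_le ((integrable_indicator_iff measurableSet_ball).2 (hintP.const_mul B₂)) (ae_of_all _ hind)
      _ = B₂ * ∫ y in ball (0 : EuclideanSpace ℝ (Fin 3)) (r' * l), |P y| := by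
          rw [integral_indicator measurableSet_ball, integral_const_mul]
      _ ≤ B₂ * (D' * (r' * l) ^ (1 - 2 * ρ) * Real.log (r' * l)) := by
          refine mul_le_mul_of_nonneg_left ?_ hB₂0
          refine (hD (r' * l) hrl2).trans ?_
          have hpw : 0 ≤ (r' * l) ^ (1 - 2 * ρ) * Real.log (r' * l) := mul_nonneg (Real.rpow_nonneg (by positivity) _) hlogrl
          calc D * (r' * l) ^ (1 - 2 * ρ) * Real.log (r' * l) = D * ((r' * l) ^ (1 - 2 * ρ) * Real.log (r' * l)) := by ring
            _ ≤ D' * ((r' * l) ^ (1 - 2 * ρ) * Real.log (r' * l)) := mul_le_mul_of_nonneg_right (le_max_left _ _) hpw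
            _ = D' * (r' * l) ^ (1 - 2 * ρ) * Real.log (r' * l) := by ring
  -- the derivative bound
  set K₀ : ℝ := (2 + ρ) * (B₁ * A' + B₂ * D' * (1 + Real.log r')) * r' ^ (1 - 2 * ρ) with hK₀def
  have hK₀ : 0 ≤ K₀ := by positivity
  have hderiv : ∀ l : ℝ, 0 < l → HasDerivAt (fun l' : ℝ => l' ^ (ρ - 2) * ∫ y, ⟪V y, φ (l'⁻¹ • y)⟫)
      ((2 + ρ) * l ^ (ρ - 4) *
        ∫ z, (⟪V z, fderiv ℝ φ (l⁻¹ • z) (V z)⟫ + P z * VectorCalculus.divergence φ (l⁻¹ • z))) l :=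
    fun l hl => traceDerivativeIdentity h2ρ.ne' V P hprof φ hφ hφc l hl
  -- split the integral of the sum (both pieces integrable: continuous with compact support)
  have hsplit : ∀ l : ℝ, 0 < l → ∫ z, (⟪V z, fderiv ℝ φ (l⁻¹ • z) (V z)⟫ + P z * VectorCalculus.divergence φ (l⁻¹ • z)) =
      (∫ z, ⟪V z, fderiv ℝ φ (l⁻¹ • z) (V z)⟫) + ∫ z, P z * VectorCalculus.divergence φ (l⁻¹ • z) := by
    intro l hl
    have hDφc : Continuous (fderiv ℝ φ) := hφ.continuous_fderiv one_ne_zero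
    have hsm : Continuous fun y : EuclideanSpace ℝ (Fin 3) => l⁻¹ • y := continuous_const_smul l⁻¹
    have hcs : ∀ {f : EuclideanSpace ℝ (Fin 3) → ℝ}, Continuous f → (∀ y, r' * l < ‖y‖ → f y = 0) → Integrable f := by
      intro f hf hf0
      refine hf.integrable_of_hasCompactSupport (HasCompactSupport.of_support_subset_isCompact
        (isCompact_closedBall (0 : EuclideanSpace ℝ (Fin 3)) (r' * l)) fun y hy => ?_)
      rw [mem_closedBall, dist_zero_right]
      by_contra hcon
      exact hy (hf0 y (not_le.1 hcon))
    refine integral_add (hcs (hVc.inner ((hDφc.comp hsm).clm_apply hVc)) fun y hy => ?_) (hcs (hPc.mul (hdivc.comp hsm)) fun y hy => ?_)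
    · rw [hDφ0' _ (hfar_of hl hy.le), zero_apply, inner_zero_right]
    · rw [divergence_eq_zero_of_fderiv_eq_zero (hDφ0' _ (hfar_of hl hy.le)), mul_zero]
  have hbd : ∀ l : ℝ, 1 ≤ l → |(2 + ρ) * l ^ (ρ - 4) *
      ∫ z, (⟪V z, fderiv ℝ φ (l⁻¹ • z) (V z)⟫ + P z * VectorCalculus.divergence φ (l⁻¹ • z))| ≤
        K₀ * l ^ (-1 - (2 + ρ)) * (1 + Real.log l) := by
    intro l hl
    have hl0 : 0 < l := by linarith
    have hlogl : 0 ≤ Real.log l := Real.log_nonneg hl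
    have hlogsplit : Real.log (r' * l) ≤ (1 + Real.log r') * (1 + Real.log l) := by
      rw [Real.log_mul hr'0.ne' hl0.ne']; nlinarith
    rw [hsplit l hl0, abs_mul, abs_mul, abs_of_pos h2ρ, abs_of_pos (Real.rpow_pos_of_pos hl0 _)]
    have hpw0 : 0 ≤ (r' * l) ^ (1 - 2 * ρ) := Real.rpow_nonneg (by positivity) _
    have hsum : |(∫ z, ⟪V z, fderiv ℝ φ (l⁻¹ • z) (V z)⟫) + ∫ z, P z * VectorCalculus.divergence φ (l⁻¹ • z)| ≤
        (B₁ * A' + B₂ * D' * (1 + Real.log r')) * (1 + Real.log l) * (r' * l) ^ (1 - 2 * ρ) := by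
      calc |(∫ z, ⟪V z, fderiv ℝ φ (l⁻¹ • z) (V z)⟫) + ∫ z, P z * VectorCalculus.divergence φ (l⁻¹ • z)|
          ≤ |∫ z, ⟪V z, fderiv ℝ φ (l⁻¹ • z) (V z)⟫| + |∫ z, P z * VectorCalculus.divergence φ (l⁻¹ • z)| := abs_add_le _ _
        _ ≤ B₁ * (A' * (r' * l) ^ (1 - 2 * ρ)) + B₂ * (D' * (r' * l) ^ (1 - 2 * ρ) * Real.log (r' * l)) := add_le_add (hK l hl) (hPr l hl)
        _ = (B₁ * A' + B₂ * D' * Real.log (r' * l)) * (r' * l) ^ (1 - 2 * ρ) := by ring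
        _ ≤ (B₁ * A' + B₂ * D' * (1 + Real.log r')) * (1 + Real.log l) * (r' * l) ^ (1 - 2 * ρ) := by
          apply mul_le_mul_of_nonneg_right _ hpw0
          have h1 : B₁ * A' ≤ B₁ * A' * (1 + Real.log l) := by nlinarith [mul_nonneg hB₁ hA'0]
          have h2 : B₂ * D' * Real.log (r' * l) ≤ B₂ * D' * ((1 + Real.log r') * (1 + Real.log l)) :=
            mul_le_mul_of_nonneg_left hlogsplit (mul_nonneg hB₂0 hD'0)
          nlinarith
    calc (2 + ρ) * l ^ (ρ - 4) * |(∫ z, ⟪V z, fderiv ℝ φ (l⁻¹ • z) (V z)⟫) + ∫ z, P z * VectorCalculus.divergence φ (l⁻¹ • z)|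
        ≤ (2 + ρ) * l ^ (ρ - 4) * ((B₁ * A' + B₂ * D' * (1 + Real.log r')) * (1 + Real.log l) * (r' * l) ^ (1 - 2 * ρ)) :=
          mul_le_mul_of_nonneg_left hsum (by positivity)
      _ = K₀ * l ^ (-1 - (2 + ρ)) * (1 + Real.log l) := by
          rw [hK₀def, Real.mul_rpow hr'0.le hl0.le]
          have e : l ^ (ρ - 4) * l ^ (1 - 2 * ρ) = l ^ (-1 - (2 + ρ)) := by
            rw [← Real.rpow_add hl0]; congr 1; ring
          calc (2 + ρ) * l ^ (ρ - 4) * ((B₁ * A' + B₂ * D' * (1 + Real.log r')) * (1 + Real.log l) * (r' ^ (1 - 2 * ρ) * l ^ (1 - 2 * ρ)))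
              = (2 + ρ) * (B₁ * A' + B₂ * D' * (1 + Real.log r')) * r' ^ (1 - 2 * ρ) * (l ^ (ρ - 4) * l ^ (1 - 2 * ρ)) * (1 + Real.log l) := by ring
            _ = (2 + ρ) * (B₁ * A' + B₂ * D' * (1 + Real.log r')) * r' ^ (1 - 2 * ρ) * l ^ (-1 - (2 + ρ)) * (1 + Real.log l) := by rw [e]
  obtain ⟨L, hL⟩ := exists_limit_of_deriv_bound_log h2ρ hK₀ hderiv hbd
  refine ⟨L, K₀ * ((2 + ρ) + 1) / (2 + ρ) ^ 2, fun l hl => ?_⟩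
  have := hL l (by linarith)
  simpa [mul_assoc] using this

end Summit.NavierStokesRegularity.NavierStokesRegularity.Theorems.PowerGaugeEulerLiouville.WeakTrace

end
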